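import Mathlib

/-!
# SEIL-F outer end: the boosted-Gaussian polar closure for plane-wave data and the roll cap
(solo-blind s87, kernel #198; PLAN §109 (i))

Architecture A‴ of LEMMA R (kernel #197) needs an explicit parametrix for UNIT MODE DATA
`cos(mθ) = ½(e^{imθ} + e^{-imθ})`, not only for the frame's source profile.  Near a pole the streak
amplitude obeys `A_t = K₀ A_xx - iκ x² A` (kernel #195), and for a plane-wave datum `½ e^{±imx}`
the BOOSTED GAUSSIAN `A = c · exp(-a x² + p x)` is an exact invariant family:

  `a' = iκ - 4K₀a²`,  `p' = -4K₀ a p`,  `c' = K₀ (p² - 2a) c`,   from `(a, p, c)(0) = (0, ±im, ½)`.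

(The datum wavenumber `p` is forgotten at rate `4K₀a`; in the overlap with the bulk WKB formula
`p ≈ im + 2mK₀I_B`, `c ≈ ½ e^{-K₀m²ℓ - iK₀I_B}`.)  The ROLL cap is explicit as well: with
`u = x² R` the roll diffusion `K₀(u_xx - 2u/x²)` is the 5-D radial Laplacian `K₀(R_xx + 4R_x/x)`,
and `R = ρ e^{-a x²}` is invariant under `R_t = K₀(R_xx + 4R_x/x) - iκx²R` iff
`a' = iκ - 4K₀a²`, `ρ' = -10K₀ a ρ` (the law of `γ` in #195).  This file certifies both identities
pointwise (every `x : ℂ`), in the style of #195: closed-form `x`-derivatives + the chain rule in `t`.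
-/

namespace Summit.AnomalousDissipation.AnomalousDissipation.Theorems

open Complex

/-! ### The boosted Gaussian `c e^{-a x² + p x}` -/

/-- The boosted Gaussian as a function of time `t` and the (complex) polar variable `x`. -/
noncomputable def boostedGaussian (a p c : ℝ → ℂ) (t : ℝ) (x : ℂ) : ℂ :=
  c t * cexp (-(a t * x ^ 2) + p t * x)

/-- Its first `x`-derivative in closed form. -/
noncomputable def boostedGaussian_x (a p c : ℝ → ℂ) (t : ℝ) (x : ℂ) : ℂ :=
  c t * (-(2 * a t * x) + p t) * cexp (-(a t * x ^ 2) + p t * x)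

/-- Its second `x`-derivative in closed form. -/
noncomputable def boostedGaussian_xx (a p c : ℝ → ℂ) (t : ℝ) (x : ℂ) : ℂ :=
  c t * ((-(2 * a t * x) + p t) ^ 2 - 2 * a t) * cexp (-(a t * x ^ 2) + p t * x)

/-- The exponent `-(α x²) + π x` has derivative `-(2 α x) + π`. -/
theorem boosted_exponent_hasDerivAt (α π z : ℂ) :
    HasDerivAt (fun w : ℂ => -(α * w ^ 2) + π * w) (-(2 * α * z) + π) z := by
  have h1 : HasDerivAt (fun w : ℂ => -(α * w ^ 2)) (-(α * (2 * z))) z := by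
    have h := ((hasDerivAt_pow 2 z).const_mul α).neg
    exact h.congr_deriv (by simp)
  have h2 : HasDerivAt (fun w : ℂ => π * w) π z := by
    simpa using (hasDerivAt_id z).const_mul π
  exact (h1.add h2).congr_deriv (by ring)

/-- `boostedGaussian_x` is the `x`-derivative of `boostedGaussian`. -/
theorem boostedGaussian_hasDerivAt_x (a p c : ℝ → ℂ) (t : ℝ) (z : ℂ) :
    HasDerivAt (fun w => boostedGaussian a p c t w) (boostedGaussian_x a p c t z) z := by
  unfold boostedGaussian boostedGaussian_x
  have hexp := (boosted_exponent_hasDerivAt (a t) (p t) z).cexp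
  have h := hexp.const_mul (c t)
  exact h.congr_deriv (by ring)

/-- `boostedGaussian_xx` is the `x`-derivative of `boostedGaussian_x`. -/
theorem boostedGaussian_hasDerivAt_xx (a p c : ℝ → ℂ) (t : ℝ) (z : ℂ) :
    HasDerivAt (fun w => boostedGaussian_x a p c t w) (boostedGaussian_xx a p c t z) z := by
  unfold boostedGaussian_x boostedGaussian_xx
  have hlin : HasDerivAt (fun w : ℂ => -(2 * a t * w) + p t) (-(2 * a t)) z := by
    have h := ((hasDerivAt_id z).const_mul (2 * a t)).neg.add_const (p t)
    exact h.congr_deriv (by simp)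
  have hexp := (boosted_exponent_hasDerivAt (a t) (p t) z).cexp
  have h := (hlin.mul hexp).const_mul (c t)
  have hfun : (fun w => c t * (-(2 * a t * w) + p t) * cexp (-(a t * w ^ 2) + p t * w))
      = fun w => c t * ((-(2 * a t * w) + p t) * cexp (-(a t * w ^ 2) + p t * w)) := by
    funext w; ring
  rw [hfun]
  exact h.congr_deriv (by ring)

/-- Time derivative of the boosted Gaussian (chain rule in `t`, `x` fixed). -/
theorem boostedGaussian_hasDerivAt_t {a p c : ℝ → ℂ} {a' p' c' : ℂ} {t : ℝ} (x : ℂ)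
    (ha : HasDerivAt a a' t) (hp : HasDerivAt p p' t) (hc : HasDerivAt c c' t) :
    HasDerivAt (fun τ => boostedGaussian a p c τ x)
      ((c' + c t * (-(a' * x ^ 2) + p' * x)) * cexp (-(a t * x ^ 2) + p t * x)) t := by
  unfold boostedGaussian
  have hin : HasDerivAt (fun τ => -(a τ * x ^ 2) + p τ * x) (-(a' * x ^ 2) + p' * x) t :=
    ((ha.mul_const (x ^ 2)).neg).add (hp.mul_const x)
  have hexp : HasDerivAt (fun τ => cexp (-(a τ * x ^ 2) + p τ * x))
      (cexp (-(a t * x ^ 2) + p t * x) * (-(a' * x ^ 2) + p' * x)) t := hin.cexp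
  have h := hc.mul hexp
  exact h.congr_deriv (by ring)

/-- MAIN IDENTITY (plane-wave datum closure).  Under `a' = iκ - 4K₀a²`, `p' = -4K₀ a p`,
`c' = K₀ (p² - 2a) c` the boosted Gaussian solves `A_t = K₀ A_xx - iκ x² A` at `(t, x)` for every
`x : ℂ`; `κ, K₀` instantaneous (no frozen-coefficient assumption). -/
theorem boostedGaussian_solves {a p c : ℝ → ℂ} {t : ℝ} (K₀ κ : ℂ) (x : ℂ)
    (ha : HasDerivAt a (I * κ - 4 * K₀ * a t ^ 2) t)
    (hp : HasDerivAt p (-4 * K₀ * a t * p t) t)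
    (hc : HasDerivAt c (K₀ * (p t ^ 2 - 2 * a t) * c t) t) :
    HasDerivAt (fun τ => boostedGaussian a p c τ x)
      (K₀ * boostedGaussian_xx a p c t x - I * κ * x ^ 2 * boostedGaussian a p c t x) t := by
  have h := boostedGaussian_hasDerivAt_t x ha hp hc
  refine h.congr_deriv ?_
  unfold boostedGaussian boostedGaussian_xx
  ring

/-- The initial data of the closure for the datum `½ e^{±imx}`: at `a = 0`, `p = ±im`, `c = ½`
the boosted Gaussian IS the datum. -/
theorem boostedGaussian_initial (a p c : ℝ → ℂ) (t : ℝ) (m : ℝ) (s : ℂ) (x : ℂ)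
    (ha : a t = 0) (hp : p t = s * I * m) (hc : c t = 1 / 2) :
    boostedGaussian a p c t x = 1 / 2 * cexp (s * I * m * x) := by
  unfold boostedGaussian
  rw [ha, hp, hc]; simp

/-! ### The roll cap: 5-D radial Gaussian `ρ e^{-a x²}` -/

/-- The roll-cap ansatz `R = ρ e^{-a x²}` (roll content `u = x² R` near a pole). -/
noncomputable def rollCap (a ρ : ℝ → ℂ) (t : ℝ) (x : ℂ) : ℂ :=
  ρ t * cexp (-(a t * x ^ 2))

/-- First `x`-derivative `R_x = -2 a x ρ e^{-a x²}`. -/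
noncomputable def rollCap_x (a ρ : ℝ → ℂ) (t : ℝ) (x : ℂ) : ℂ :=
  -(2 * a t * x) * ρ t * cexp (-(a t * x ^ 2))

/-- Second `x`-derivative `R_xx = (4a²x² - 2a) ρ e^{-a x²}`. -/
noncomputable def rollCap_xx (a ρ : ℝ → ℂ) (t : ℝ) (x : ℂ) : ℂ :=
  (4 * a t ^ 2 * x ^ 2 - 2 * a t) * ρ t * cexp (-(a t * x ^ 2))

/-- `rollCap_x` is the `x`-derivative of `rollCap`. -/
theorem rollCap_hasDerivAt_x (a ρ : ℝ → ℂ) (t : ℝ) (z : ℂ) :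
    HasDerivAt (fun w => rollCap a ρ t w) (rollCap_x a ρ t z) z := by
  unfold rollCap rollCap_x
  have hin : HasDerivAt (fun w : ℂ => -(a t * w ^ 2)) (-(a t * (2 * z))) z := by
    have h := ((hasDerivAt_pow 2 z).const_mul (a t)).neg
    exact h.congr_deriv (by simp)
  have h := hin.cexp.const_mul (ρ t)
  exact h.congr_deriv (by ring)

/-- `rollCap_xx` is the `x`-derivative of `rollCap_x`. -/
theorem rollCap_hasDerivAt_xx (a ρ : ℝ → ℂ) (t : ℝ) (z : ℂ) :
    HasDerivAt (fun w => rollCap_x a ρ t w) (rollCap_xx a ρ t z) z := by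
  unfold rollCap_x rollCap_xx
  have hin : HasDerivAt (fun w : ℂ => -(a t * w ^ 2)) (-(a t * (2 * z))) z := by
    have h := ((hasDerivAt_pow 2 z).const_mul (a t)).neg
    exact h.congr_deriv (by simp)
  have hlin : HasDerivAt (fun w : ℂ => -(2 * a t * w) * ρ t) (-(2 * a t) * ρ t) z := by
    have h := (((hasDerivAt_id z).const_mul (2 * a t)).neg).mul_const (ρ t)
    exact h.congr_deriv (by simp)
  have h := hlin.mul hin.cexp
  exact h.congr_deriv (by ring)

/-- Time derivative of the roll cap (chain rule in `t`). -/
theorem rollCap_hasDerivAt_t {a ρ : ℝ → ℂ} {a' ρ' : ℂ} {t : ℝ} (x : ℂ)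
    (ha : HasDerivAt a a' t) (hρ : HasDerivAt ρ ρ' t) :
    HasDerivAt (fun τ => rollCap a ρ τ x)
      ((ρ' - ρ t * (a' * x ^ 2)) * cexp (-(a t * x ^ 2))) t := by
  unfold rollCap
  have hin : HasDerivAt (fun τ => -(a τ * x ^ 2)) (-(a' * x ^ 2)) t := (ha.mul_const (x ^ 2)).neg
  have h := hρ.mul hin.cexp
  exact h.congr_deriv (by ring)

/-- MAIN IDENTITY (roll cap), multiplied through by `x` so that it holds at `x = 0` too:
under `a' = iκ - 4K₀a²`, `ρ' = -10 K₀ a ρ`,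
`x · R_t = K₀ (x R_xx + 4 R_x) - iκ x³ R`, i.e. `R_t = K₀(R_xx + 4R_x/x) - iκx²R` for `x ≠ 0`
(the 5-D radial heat operator with quadratic potential). -/
theorem rollCap_solves_mul {a ρ : ℝ → ℂ} {t : ℝ} (K₀ κ : ℂ) (x : ℂ)
    (ha : HasDerivAt a (I * κ - 4 * K₀ * a t ^ 2) t)
    (hρ : HasDerivAt ρ (-10 * K₀ * a t * ρ t) t) :
    HasDerivAt (fun τ => x * rollCap a ρ τ x)
      (K₀ * (x * rollCap_xx a ρ t x + 4 * rollCap_x a ρ t x) - I * κ * x ^ 3 * rollCap a ρ t x) t := by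
  have h := (rollCap_hasDerivAt_t x ha hρ).const_mul x
  refine h.congr_deriv ?_
  unfold rollCap rollCap_x rollCap_xx
  ring

/-- The divided form for `x ≠ 0`: `R_t = K₀ (R_xx + 4 R_x / x) - iκ x² R`. -/
theorem rollCap_solves {a ρ : ℝ → ℂ} {t : ℝ} (K₀ κ : ℂ) {x : ℂ} (hx : x ≠ 0)
    (ha : HasDerivAt a (I * κ - 4 * K₀ * a t ^ 2) t)
    (hρ : HasDerivAt ρ (-10 * K₀ * a t * ρ t) t) :
    HasDerivAt (fun τ => rollCap a ρ τ x)
      (K₀ * (rollCap_xx a ρ t x + 4 * rollCap_x a ρ t x / x) - I * κ * x ^ 2 * rollCap a ρ t x) t := by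
  have h := rollCap_hasDerivAt_t x ha hρ
  refine h.congr_deriv ?_
  unfold rollCap rollCap_x rollCap_xx
  field_simp
  ring

/-- The 5-D structure: `u = x² R` turns the roll operator `u_xx - 2u/x²` into `x² (R_xx + 4R_x/x)`;
here as the polynomial identity behind it, for the closed forms above (`x ≠ 0`). -/
theorem rollCap_fiveD (a ρ : ℝ → ℂ) (t : ℝ) {x : ℂ} (hx : x ≠ 0) :
    (2 * rollCap a ρ t x + 4 * x * rollCap_x a ρ t x + x ^ 2 * rollCap_xx a ρ t x)
      - 2 * (x ^ 2 * rollCap a ρ t x) / x ^ 2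
      = x ^ 2 * (rollCap_xx a ρ t x + 4 * rollCap_x a ρ t x / x) := by
  unfold rollCap rollCap_x rollCap_xx
  field_simp
  ring

/-- The Orr kill exponent of the bulk parametrix for the datum `e^{±imθ}`: the WKB amplitude
exponent `-(B sin θ ∓ m)²` expands as `-B² sin²θ ± 2 B m sin θ - m²` — the modal damping `m²`,
the Kelvin kill `B² sin²θ`, and the cross term through which the `e^{-imθ}` component un-shears. -/
theorem orrKill_expand (B m s : ℝ) :
    -(B * s - m) ^ 2 = -(B ^ 2 * s ^ 2) + 2 * B * m * s - m ^ 2 := by ring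

end Summit.AnomalousDissipation.AnomalousDissipation.Theorems
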